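import Literature.LinearAlgebra.Matrix.IntegerEigenvaluesUpperTriangular
import HarnessLib

/-!
# Integer matrices with a single (nilpotent) Jordan block, any rank: strictly upper triangular semi-normal form
# with POSITIVE superdiagonal, `Tⁿ⁻¹ = (∏ superdiagonal)·E_{1n}`, and «infinite if `f` has multiple roots»
# (Hertling–Larabi 2026b §10.1 (10.2) with Theorem 6.3; §1)

[topic LinearAlgebra/Matrix] Lane `lit-hodgefound` (Track 2 foundations library), seat p19 generation 40, row g40-#8.
Sequel of `IntegerEigenvaluesUpperTriangular` §4 (g40-#6: a nilpotent integer matrix is `GLₙ(ℤ)`-conjugate to a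
strictly upper triangular one), REUSED.  General-rank companion of the rank-3 normal form
`GL3ZNilpotentNormalForm.existsUnique_conj_normalForm` (g40-#1, HL Thm. 10.7 (d): `(0 m₁ −m₃; 0 0 m₂; 0 0 0)`,
`m₁, m₂ ∈ ℕ`).  THEOREMS ONLY: no definition, no instance, no notation, no named fact (D-0026, net Literature debt
`0`), no `sorry`.  Matrices are indexed by `Fin (n + 1)` (rank `n + 1 ≥ 1`; the superdiagonal is
`t.castSucc, t.succ` for `t : Fin n`).

## Source, VERBATIM

C. Hertling, K. Larabi, *Conjugacy classes of regular integer matrices*, arXiv:2602.15748 (2026)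
[HertlingLarabi2026b], held `paper:arxiv-2602.15748`.
* Abstract, chunk p0002: «the set of `GL_n(ℤ)`-conjugacy classes of regular integer matrices with a fixed
  characteristic polynomial `f` is usually nontrivial (finite if `f` has simple roots, infinite if `f` has multiple
  roots).»  §1, chunk p0003: «The set `S_{1,f}` of `GL_n(ℤ)`-conjugacy classes of regular matrices in `M_{n×n}(ℤ)`
  with a fixed not semisimple Jordan normal form (i.e. the characteristic polynomial `f` has multiple roots) is
  infinite, but a single additional invariant splits it into infinitely many finite sets.»
* §10.1, chunk p0033: «Let `n ∈ ℕ`. An integer `n×n` matrix with a single Jordan block has one integer eigenvalue.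
  We can restrict to the eigenvalue `0`, so the nilpotent case […] The corresponding algebra is
  `A = ℚ·1_A ⊕ ℚ·a + ... + ℚ·a^{n−1}` with `aⁿ = 0`. […] The conjugacy classes of integer `n×n` matrices correspond
  1:1 to the `ε`-classes of `Λ_a`-ideals `{[L]_ε | L ∈ 𝓛(A), 𝒪(L) ⊃ Λ_a}` […] Here a `ℤ`-basis `𝓑 ∈ M_{1×n}(L)` of a
  `Λ_a`-ideal `L` gives rise to the matrix `M ∈ M_{n×n}(ℤ)` with `a·𝓑 = 𝓑·M`. […] Each full lattice `L ∈ 𝓛(A)`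
  has a unique `ℤ`-basis of the shape `a·(β_{ij})` [(10.2), lower triangular in `a = (1_A, a, …, a^{n−1})`] with
  `β_{ii} ∈ ℚ_{>0}` for `1 ≤ i ≤ n` and `β_{ij} ∈ (−½β_{ii}, ½β_{ii}] ∩ ℚ` for `i > j`.»  (In the basis (10.2), read
  backwards, `M` is strictly upper triangular with superdiagonal entries `β_{ii}/β_{i+1,i+1} > 0`.)

## What is proved (`T, N : Matrix (Fin (n + 1)) (Fin (n + 1)) ℤ`; `B ∼ B′ :⟺ ∃ P, det P = ±1, PB = B′P`)

* §1 strictly upper triangular `T` (`T.BlockTriangular id`, zero diagonal): `pow_apply_eq_zero_of_lt`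
  (`(Tᵏ) a b = 0` for `b < a + k`), `pow_card_eq_zero` (`Tⁿ⁺¹ = 0`), **`pow_eq_smul_single`**
  (`Tⁿ = (∏ₜ T_{t,t+1})·E_{0,n}`), `pow_ne_zero_iff` (`Tⁿ ≠ 0 ⟺` all superdiagonal entries `≠ 0`).
* §2 **`exists_conj_strictUpperTriangular_pos`**: a nilpotent `N` with `Nⁿ ≠ 0` (a single Jordan block) is
  `GLₙ₊₁(ℤ)`-conjugate to a strictly upper triangular integer matrix with POSITIVE superdiagonal (the semi-normal
  form (10.2) in matrix language; signs fixed by a diagonal `±1` conjugation).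
* §3 «infinite if `f` has multiple roots», the case `f = tⁿ⁺²`: the multiples `m·J`, `m ≥ 1`, of the Jordan block
  are pairwise non-conjugate (`m ∣ N` entrywise is a class invariant), so **`infinite_quot_conj`**: the
  `GLₙ₊₂(ℤ)`-classes of nilpotent `N` with `Nⁿ⁺¹ ≠ 0` form an infinite set (rank `≥ 2`); `equivalence_conj`.
-/

open Matrix

namespace Literature.LinearAlgebra.Matrix.RegularNilpotentIntegerMatrix

open Literature.LinearAlgebra.Matrix.IntegerEigenvaluesTriangular (exists_conj_strictUpperTriangular_of_isNilpotent)

variable {n : ℕ}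

/-! ## §1 Powers of a strictly upper triangular matrix -/

/-- Below-the-`k`-th-superdiagonal entries of `Tᵏ` vanish: `(Tᵏ) a b = 0` for `b < a + k`.
[cite: HertlingLarabi2026b, §10.1 («`aⁿ = 0`», the basis (10.2)), chunk p0033] -/
theorem pow_apply_eq_zero_of_lt {T : Matrix (Fin (n + 1)) (Fin (n + 1)) ℤ} (hT : T.BlockTriangular id)
    (hd : ∀ i, T i i = 0) (k : ℕ) (a b : Fin (n + 1)) (hab : (b : ℕ) < a + k) : (T ^ k) a b = 0 := by
  have hT' : ∀ a b : Fin (n + 1), (b : ℕ) ≤ a → T a b = 0 := fun a b h => by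
    rcases (Fin.le_def.2 h : b ≤ a).lt_or_eq with h' | h'
    · exact hT h'
    · rw [h', hd]
  induction k generalizing a b with
  | zero =>
    rw [pow_zero, Matrix.one_apply_ne]
    exact fun e => by rw [e, add_zero] at hab; exact lt_irrefl _ hab
  | succ k ih =>
    rw [pow_succ, Matrix.mul_apply]
    refine Finset.sum_eq_zero fun m _ => ?_
    by_cases hm : (m : ℕ) < a + k
    · rw [ih a m hm, zero_mul]
    · rw [hT' m b (by omega), mul_zero]

/-- `Tⁿ⁺¹ = 0` for a strictly upper triangular `T` of rank `n + 1`. [cite: HertlingLarabi2026b, §10.1 («`aⁿ = 0`»), chunk p0033] -/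
theorem pow_card_eq_zero {T : Matrix (Fin (n + 1)) (Fin (n + 1)) ℤ} (hT : T.BlockTriangular id)
    (hd : ∀ i, T i i = 0) : T ^ (n + 1) = 0 := by
  ext a b
  rw [Matrix.zero_apply]
  exact pow_apply_eq_zero_of_lt hT hd (n + 1) a b (by have := b.isLt; omega)

/-- The first row of the powers: `(Tᵏ⁺¹)_{0,k+1} = (Tᵏ)_{0,k} · T_{k,k+1}`. [folklore] -/
private theorem pow_succ_apply_zero {T : Matrix (Fin (n + 1)) (Fin (n + 1)) ℤ} (hT : T.BlockTriangular id)
    (hd : ∀ i, T i i = 0) (k : ℕ) (hk : k + 1 < n + 1) :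
    (T ^ (k + 1)) 0 ⟨k + 1, hk⟩ = (T ^ k) 0 ⟨k, by omega⟩ * T ⟨k, by omega⟩ ⟨k + 1, hk⟩ := by
  have hT' : ∀ a b : Fin (n + 1), (b : ℕ) ≤ a → T a b = 0 := fun a b h => by
    rcases (Fin.le_def.2 h : b ≤ a).lt_or_eq with h' | h'
    · exact hT h'
    · rw [h', hd]
  rw [pow_succ, Matrix.mul_apply]
  refine Finset.sum_eq_single (⟨k, by omega⟩ : Fin (n + 1)) (fun m _ hm => ?_) (fun h => absurd (Finset.mem_univ _) h)
  by_cases hmk : (m : ℕ) < k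
  · rw [pow_apply_eq_zero_of_lt hT hd k 0 m (by simpa using hmk), zero_mul]
  · have hmk' : k < (m : ℕ) := lt_of_le_of_ne (not_lt.1 hmk) fun e => hm (Fin.ext e.symm)
    rw [hT' m _ (by simpa using hmk'), mul_zero]

/-- The first row of the powers: `(Tᵏ)_{0,k} = ∏_{t<k} T_{t,t+1}`. [folklore] -/
private theorem pow_apply_zero {T : Matrix (Fin (n + 1)) (Fin (n + 1)) ℤ} (hT : T.BlockTriangular id)
    (hd : ∀ i, T i i = 0) (k : ℕ) (hk : k < n + 1) :
    (T ^ k) 0 ⟨k, hk⟩ = ∏ t ∈ Finset.range k,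
      (if h : t + 1 < n + 1 then T ⟨t, by omega⟩ ⟨t + 1, h⟩ else 0) := by
  induction k with
  | zero => rw [Finset.prod_range_zero, pow_zero]; exact Matrix.one_apply_eq _
  | succ k ih =>
    rw [pow_succ_apply_zero hT hd k hk, ih (by omega), Finset.prod_range_succ, dif_pos hk]

/-- **`Tⁿ = (∏ₜ T_{t,t+1}) · E_{0,n}`** for a strictly upper triangular `T` of rank `n + 1`: the only entry of `Tⁿ`
that can survive is the corner, and it is the product of the superdiagonal («`a^{n−1} ≠ 0 = aⁿ`»: in the basis
(10.2) `a^{n−1}·b₁ = (∏ β_{ii}/β_{i+1,i+1})·bₙ`). [cite: HertlingLarabi2026b, §10.1 (10.1)–(10.2), chunk p0033] -/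
theorem pow_eq_smul_single {T : Matrix (Fin (n + 1)) (Fin (n + 1)) ℤ} (hT : T.BlockTriangular id)
    (hd : ∀ i, T i i = 0) :
    T ^ n = (∏ t : Fin n, T t.castSucc t.succ) • Matrix.single (0 : Fin (n + 1)) (Fin.last n) (1 : ℤ) := by
  ext a b
  rw [Matrix.smul_apply, smul_eq_mul]
  by_cases hab : a = 0 ∧ b = Fin.last n
  · obtain ⟨rfl, rfl⟩ := hab
    rw [Matrix.single_apply_same, mul_one]
    have e := pow_apply_zero hT hd n (Nat.lt_succ_self n)
    rw [Finset.prod_range] at e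
    rw [show (Fin.last n : Fin (n + 1)) = ⟨n, Nat.lt_succ_self n⟩ from rfl, e]
    refine Finset.prod_congr rfl fun t _ => ?_
    rw [dif_pos (by have := t.isLt; omega)]
    rfl
  · have hne : ¬((0 : Fin (n + 1)) = a ∧ Fin.last n = b) := fun h => hab ⟨h.1.symm, h.2.symm⟩
    rw [Matrix.single_apply_of_ne (h := hne), mul_zero]
    refine pow_apply_eq_zero_of_lt hT hd n a b ?_
    have ha := a.isLt; have hb := b.isLt
    by_contra hlt
    refine hab ⟨Fin.ext ?_, Fin.ext ?_⟩
    · change (a : ℕ) = 0; omega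
    · change (b : ℕ) = n; omega

/-- **`Tⁿ ≠ 0` iff every superdiagonal entry is nonzero** (a single Jordan block iff `a^{n−1}` acts nontrivially).
[cite: HertlingLarabi2026b, §10.1 (10.1)–(10.2), chunk p0033] -/
theorem pow_ne_zero_iff {T : Matrix (Fin (n + 1)) (Fin (n + 1)) ℤ} (hT : T.BlockTriangular id)
    (hd : ∀ i, T i i = 0) : T ^ n ≠ 0 ↔ ∀ t : Fin n, T t.castSucc t.succ ≠ 0 := by
  rw [pow_eq_smul_single hT hd, Ne, smul_eq_zero, not_or, Finset.prod_eq_zero_iff]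
  simp only [Finset.mem_univ, true_and, not_exists]
  constructor
  · exact fun h => h.1
  · refine fun h => ⟨h, fun h0 => ?_⟩
    have e := congr_fun (congr_fun h0 0) (Fin.last n)
    rw [Matrix.single_apply_same, Matrix.zero_apply] at e
    exact one_ne_zero e

/-! ## §2 The semi-normal form: strictly upper triangular with positive superdiagonal -/

/-- Intertwining passes to powers. [folklore] -/
private theorem conj_pow {N N' P : Matrix (Fin (n + 1)) (Fin (n + 1)) ℤ} (h : P * N = N' * P) (k : ℕ) :
    P * N ^ k = N' ^ k * P := by
  induction k with
  | zero => rw [pow_zero, pow_zero, mul_one, one_mul]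
  | succ k ih => rw [pow_succ, ← mul_assoc, ih, mul_assoc, h, ← mul_assoc, ← pow_succ]

/-- **A nilpotent integer matrix of rank `n + 1` with `Nⁿ ≠ 0` (a single Jordan block) is `GLₙ₊₁(ℤ)`-conjugate to
a strictly upper triangular integer matrix with POSITIVE superdiagonal entries** — the matrix of `a` in the
triangular `ℤ`-basis (10.2) (`β_{ii} > 0`) of the corresponding `Λ_a`-ideal, read backwards; here: triangularise
(`IntegerEigenvaluesTriangular.exists_conj_strictUpperTriangular_of_isNilpotent`), then conjugate by the diagonal
sign matrix `diag(ε)`, `ε_t = ∏_{s<t} sign T_{s,s+1}`. [cite: HertlingLarabi2026b, §10.1 (10.2), chunk p0033, with §6 Thm. 6.3, chunk p0012] -/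
theorem exists_conj_strictUpperTriangular_pos {N : Matrix (Fin (n + 1)) (Fin (n + 1)) ℤ} (hN : IsNilpotent N)
    (hreg : N ^ n ≠ 0) :
    ∃ P T : Matrix (Fin (n + 1)) (Fin (n + 1)) ℤ, IsUnit P.det ∧ P * N = T * P ∧ T.BlockTriangular id ∧
      (∀ i, T i i = 0) ∧ ∀ t : Fin n, 0 < T t.castSucc t.succ := by
  obtain ⟨P₀, T₀, hP₀, hP₀N, hT₀, hd₀⟩ := exists_conj_strictUpperTriangular_of_isNilpotent hN
  -- `T₀ⁿ ≠ 0`, so its superdiagonal entries are nonzero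
  have hT₀n : T₀ ^ n ≠ 0 := fun h0 => hreg <| by
    have e := conj_pow hP₀N n
    rw [h0, zero_mul] at e
    calc N ^ n = P₀⁻¹ * (P₀ * N ^ n) := by rw [← mul_assoc, Matrix.nonsing_inv_mul P₀ hP₀, one_mul]
      _ = 0 := by rw [e, mul_zero]
  have hsd : ∀ t : Fin n, T₀ t.castSucc t.succ ≠ 0 := (pow_ne_zero_iff hT₀ hd₀).1 hT₀n
  -- the signs
  set g : ℕ → ℤ := fun s => if h : s + 1 < n + 1 then Int.sign (T₀ ⟨s, by omega⟩ ⟨s + 1, h⟩) else 1 with hg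
  set ε : Fin (n + 1) → ℤ := fun i => ∏ s ∈ Finset.range (i : ℕ), g s with hε
  have hg1 : ∀ s, g s * g s = 1 := by
    intro s
    simp only [hg]
    split_ifs with h
    · have hne : T₀ ⟨s, by omega⟩ ⟨s + 1, h⟩ ≠ 0 := by
        have := hsd ⟨s, by omega⟩
        exact this
      rcases lt_or_gt_of_ne hne with hlt | hgt
      · rw [Int.sign_eq_neg_one_of_neg hlt]; norm_num
      · rw [Int.sign_eq_one_of_pos hgt]; norm_num
    · norm_num
  have hε1 : ∀ i, ε i * ε i = 1 := by
    intro i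
    rw [hε, ← Finset.prod_mul_distrib]
    exact Finset.prod_eq_one fun s _ => hg1 s
  have hεsucc : ∀ t : Fin n, ε t.succ = ε t.castSucc * Int.sign (T₀ t.castSucc t.succ) := by
    intro t
    simp only [hε, Fin.val_succ, Fin.val_castSucc]
    rw [Finset.prod_range_succ, hg]
    simp only
    rw [dif_pos (by have := t.isLt; omega)]
    rfl
  -- conjugate by `S = diag(ε)`, `S² = 1`
  set S : Matrix (Fin (n + 1)) (Fin (n + 1)) ℤ := diagonal ε with hS
  have hSS : S * S = 1 := by
    rw [hS, diagonal_mul_diagonal, ← diagonal_one]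
    exact congr_arg _ (funext fun i => hε1 i)
  have hSdet : IsUnit S.det := IsUnit.of_mul_eq_one _ (by rw [← det_mul, hSS, det_one])
  have hSTS : ∀ i j, (S * T₀ * S) i j = ε i * T₀ i j * ε j := by
    intro i j; rw [hS, mul_diagonal, diagonal_mul]
  refine ⟨S * P₀, S * T₀ * S, by rw [det_mul]; exact hSdet.mul hP₀, ?_, ?_, ?_, ?_⟩
  · calc S * P₀ * N = S * (T₀ * P₀) := by rw [mul_assoc, hP₀N]
      _ = S * T₀ * (S * S) * P₀ := by rw [hSS, mul_one, mul_assoc]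
      _ = S * T₀ * S * (S * P₀) := by simp only [mul_assoc]
  · intro i j hij
    rw [hSTS, hT₀ hij, mul_zero, zero_mul]
  · intro i
    rw [hSTS, hd₀, mul_zero, zero_mul]
  · intro t
    rw [hSTS, hεsucc]
    have hne := hsd t
    calc (0 : ℤ) < (T₀ t.castSucc t.succ).natAbs := by
          exact_mod_cast Int.natAbs_pos.2 hne
      _ = ε t.castSucc * ε t.castSucc * (Int.sign (T₀ t.castSucc t.succ) * T₀ t.castSucc t.succ) := by
          rw [hε1, one_mul, Int.sign_mul_self_eq_natAbs]
      _ = ε t.castSucc * T₀ t.castSucc t.succ * (ε t.castSucc * Int.sign (T₀ t.castSucc t.succ)) := by ring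

/-! ## §3 Infinitely many classes (rank `≥ 2`): the multiples of the Jordan block -/

/-- Conjugacy by `GL(ℤ)` is an equivalence relation on the nilpotent matrices with a single Jordan block.
[cite: HertlingLarabi2026b, §6 Thm. 6.3 («`GL_n(ℤ)`-conjugacy classes»), chunk p0012] -/
theorem equivalence_conj (m : ℕ) :
    Equivalence fun N N' : {N : Matrix (Fin (m + 1)) (Fin (m + 1)) ℤ // N ^ (m + 1) = 0 ∧ N ^ m ≠ 0} =>
      ∃ P : Matrix (Fin (m + 1)) (Fin (m + 1)) ℤ, IsUnit P.det ∧ P * N.1 = N'.1 * P where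
  refl N := ⟨1, by rw [det_one]; exact isUnit_one, by rw [one_mul, mul_one]⟩
  symm := by
    rintro N N' ⟨P, hP, hPN⟩
    refine ⟨P⁻¹, Matrix.isUnit_nonsing_inv_det P hP, ?_⟩
    calc P⁻¹ * N'.1 = P⁻¹ * N'.1 * (P * P⁻¹) := by rw [Matrix.mul_nonsing_inv P hP, mul_one]
      _ = P⁻¹ * (N'.1 * P) * P⁻¹ := by simp only [mul_assoc]
      _ = P⁻¹ * (P * N.1) * P⁻¹ := by rw [hPN]
      _ = N.1 * P⁻¹ := by rw [← mul_assoc, Matrix.nonsing_inv_mul P hP, one_mul]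
  trans := by
    rintro N N' N'' ⟨P, hP, hPN⟩ ⟨P', hP', hP'N⟩
    refine ⟨P' * P, by rw [det_mul]; exact hP'.mul hP, ?_⟩
    rw [mul_assoc, hPN, ← mul_assoc, hP'N, mul_assoc]

/-- If `PN = N′P` with `P ∈ GL(ℤ)` and `m` divides all entries of `N`, then `m` divides all entries of `N′`.
[folklore] -/
private theorem dvd_of_conj {N N' P : Matrix (Fin (n + 1)) (Fin (n + 1)) ℤ} (hP : IsUnit P.det)
    (h : P * N = N' * P) {m : ℤ} (hm : ∀ i j, m ∣ N i j) (i j : Fin (n + 1)) : m ∣ N' i j := by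
  obtain ⟨N₁, rfl⟩ : ∃ N₁ : Matrix (Fin (n + 1)) (Fin (n + 1)) ℤ, N = m • N₁ :=
    ⟨Matrix.of fun i j => N i j / m, by
      ext i j; rw [Matrix.smul_apply, Matrix.of_apply, smul_eq_mul, Int.mul_ediv_cancel' (hm i j)]⟩
  have e : N' = m • (P * N₁ * P⁻¹) := by
    calc N' = N' * P * P⁻¹ := by rw [Matrix.mul_nonsing_inv_cancel_right P _ hP]
      _ = P * (m • N₁) * P⁻¹ := by rw [← h]
      _ = m • (P * N₁ * P⁻¹) := by rw [Matrix.mul_smul, Matrix.smul_mul]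
  rw [e, Matrix.smul_apply, smul_eq_mul]
  exact Dvd.intro _ rfl

/-- **«Infinite if `f` has multiple roots»**, the case of a single nilpotent Jordan block of rank `n + 2 ≥ 2`: the
`GLₙ₊₂(ℤ)`-conjugacy classes of integer matrices `N` with `Nⁿ⁺² = 0 ≠ Nⁿ⁺¹` form an INFINITE set — the multiples
`m·J`, `m ≥ 1`, of the Jordan block `J` are pairwise non-conjugate, since «`m` divides `N` entrywise» is a class
invariant (the printed invariant is the order `𝒪(L)`; for `m·J` it is `ℤ + m⁻¹ℤa + ⋯`-type data determining `m`).
[cite: HertlingLarabi2026b, §1 («`S_{1,f}` … is infinite»), chunk p0003; §10.1, chunk p0033] -/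
theorem infinite_quot_conj (n : ℕ) :
    Infinite (Quot fun N N' : {N : Matrix (Fin (n + 2)) (Fin (n + 2)) ℤ // N ^ (n + 2) = 0 ∧ N ^ (n + 1) ≠ 0} =>
      ∃ P : Matrix (Fin (n + 2)) (Fin (n + 2)) ℤ, IsUnit P.det ∧ P * N.1 = N'.1 * P) := by
  classical
  -- the Jordan block
  set J : Matrix (Fin (n + 2)) (Fin (n + 2)) ℤ := Matrix.of fun i j => if (j : ℕ) = i + 1 then (1 : ℤ) else 0
    with hJ
  have hJtri : J.BlockTriangular id := fun i j hij => by
    have h : (j : ℕ) < i := hij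
    simp only [hJ, Matrix.of_apply]
    rw [if_neg (by omega)]
  have hJd : ∀ i, J i i = 0 := fun i => by
    simp only [hJ, Matrix.of_apply]; rw [if_neg (by omega)]
  have hJsd : ∀ t : Fin (n + 1), J t.castSucc t.succ = 1 := fun t => by
    simp [hJ, Fin.val_succ, Fin.val_castSucc]
  have hJpow : J ^ (n + 2) = 0 := pow_card_eq_zero hJtri hJd
  have hJreg : J ^ (n + 1) ≠ 0 := (pow_ne_zero_iff hJtri hJd).2 fun t => by rw [hJsd]; exact one_ne_zero
  -- the family `m ↦ [ (m+1)·J ]`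
  have hmem : ∀ m : ℕ, (((m + 1 : ℕ) : ℤ) • J) ^ (n + 2) = 0 ∧ (((m + 1 : ℕ) : ℤ) • J) ^ (n + 1) ≠ 0 := by
    intro m
    refine ⟨by rw [smul_pow, hJpow, smul_zero], ?_⟩
    rw [smul_pow, Ne, smul_eq_zero, not_or]
    exact ⟨pow_ne_zero _ (by exact_mod_cast Nat.succ_ne_zero m), hJreg⟩
  let F : ℕ → Quot fun N N' : {N : Matrix (Fin (n + 2)) (Fin (n + 2)) ℤ // N ^ (n + 2) = 0 ∧ N ^ (n + 1) ≠ 0} =>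
      ∃ P : Matrix (Fin (n + 2)) (Fin (n + 2)) ℤ, IsUnit P.det ∧ P * N.1 = N'.1 * P :=
    fun m => Quot.mk _ ⟨((m + 1 : ℕ) : ℤ) • J, hmem m⟩
  refine Infinite.of_injective F fun m m' hmm' => ?_
  -- equal classes ⟹ conjugate ⟹ `m + 1 ∣ m' + 1` and conversely
  have hrel := (Equivalence.eqvGen_iff (equivalence_conj (n + 1))).1 (Quot.eqvGen_exact hmm')
  obtain ⟨P', hP', hP'N'⟩ := (equivalence_conj (n + 1)).symm hrel
  obtain ⟨P, hP, hPN'⟩ := hrel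
  have hPN : P * ((((m + 1 : ℕ) : ℤ)) • J) = ((((m' + 1 : ℕ) : ℤ)) • J) * P := hPN'
  have hP'N : P' * ((((m' + 1 : ℕ) : ℤ)) • J) = ((((m + 1 : ℕ) : ℤ)) • J) * P' := hP'N'
  have h1 : ((m + 1 : ℕ) : ℤ) ∣ ((m' + 1 : ℕ) : ℤ) := by
    have h := dvd_of_conj hP hPN (m := ((m + 1 : ℕ) : ℤ))
      (fun i j => by rw [Matrix.smul_apply, smul_eq_mul]; exact Dvd.intro _ rfl) (0 : Fin (n + 1)).castSucc
      (0 : Fin (n + 1)).succ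
    rwa [Matrix.smul_apply, smul_eq_mul, hJsd, mul_one] at h
  have h2 : ((m' + 1 : ℕ) : ℤ) ∣ ((m + 1 : ℕ) : ℤ) := by
    have h := dvd_of_conj hP' hP'N (m := ((m' + 1 : ℕ) : ℤ))
      (fun i j => by rw [Matrix.smul_apply, smul_eq_mul]; exact Dvd.intro _ rfl) (0 : Fin (n + 1)).castSucc
      (0 : Fin (n + 1)).succ
    rwa [Matrix.smul_apply, smul_eq_mul, hJsd, mul_one] at h
  have := Nat.dvd_antisymm (Int.natCast_dvd_natCast.1 h1) (Int.natCast_dvd_natCast.1 h2)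
  omega

end Literature.LinearAlgebra.Matrix.RegularNilpotentIntegerMatrix
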